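import Summits.ValiantsHypothesis.ValiantsHypothesis.Theses.FermionizationDimension
import Summits.ValiantsHypothesis.ValiantsHypothesis.Theorems.FermionizationDimensionSDimPerNotQPGlobalExpansion
import Summits.ValiantsHypothesis.ValiantsHypothesis.Theorems.TwistedDetRankTdrSuperadditive

/-!
# Route FermionizationDimension — crux `SDimPerNotQP` (stmt-ValiantsHypothesis-7286):
# calibration — the expansion bound on the twisted-determinantal rank

Auxiliary registered stub `stub_expansionBound` of the line `registered` of
`Cruxes/SDimPerNotQP/Lines/birth.lean` (calibration of the transfer stub J_tr, not a hypothesis of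
the composition): a commutative realisation `(R, u, ℓ)` of the sign character of `𝔖ₙ` of dimension
`d = finrank ℂ R` yields a representation of the permanent as a sum of at most `(n+1)^d · d^d`
Hadamard-twisted determinants, `per_n = Σ_{t<r} det (X ∘ E_t)`, `r ≤ (n+1)^d d^d`. In words:
`tdr(per_n) ≤ (n+1)^{s(n)} s(n)^{s(n)}`, i.e. `s(n) · log₂((n+1) s(n)) ≥ log₂ tdr(per_n)` —
nilpotents buy at most an exponential-in-dimension factor over idempotents (the line's bet J_tr
asks for quasi-polynomial). This is the pattern bound `FermionizationDimensionSDimPerNotQPGlobalExpansion.stub_globalExpansion`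
(Theorems/FermionizationDimensionSDimPerNotQPGlobalExpansion.lean) followed by the usual
bookkeeping: reindex by `Fin r`, absorb the scalars into a column (`n ≥ 1`), compare coefficients
of permutation monomials (`TwistedDetRankTdrSuperadditive.perPoly_eq_sum_twistedDet_iff`);
`n = 0`: one empty determinant.

Sources: folklore; M. Marcus, H. Minc, Illinois J. Math. 5 (1961) (the model).
-/

-- `Summit.<Summit>.<Problem>` repeats `ValiantsHypothesis` by the tree's layout convention (D-0017).
set_option linter.dupNamespace false

namespace Summit.ValiantsHypothesis.ValiantsHypothesis.Theorems

open TwistedDetRankTdrSuperadditive in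
/-- **Calibration — expansion bound** (auxiliary registered stub `stub_expansionBound` of the line
`registered` of crux `SDimPerNotQP`, stmt-ValiantsHypothesis-7286): a commutative realisation of
`sgn_n` of dimension `d` gives `per_n` as a sum of at most `(n+1)^d · d^d` Hadamard-twisted
determinants. [folklore; MarcusMinc1961] -/
theorem stub_expansionBound :
    ∀ (n : ℕ) (R : Type) [CommRing R] [Algebra ℂ R] [Module.Finite ℂ R] (u : Fin n → Fin n → R) (ℓ : R →ₗ[ℂ] ℂ), (∀ σ : Equiv.Perm (Fin n), ℓ (∏ i, u (σ i) i) = ((Equiv.Perm.sign σ : ℤ) : ℂ)) → ∃ r ≤ (n + 1) ^ Module.finrank ℂ R * Module.finrank ℂ R ^ Module.finrank ℂ R, ∃ E : Fin r → Matrix (Fin n) (Fin n) ℂ, Literature.Computability.AlgebraicComplexity.perPoly (Fin n) ℂ = ∑ t, (Matrix.of fun i j => MvPolynomial.C (E t i j) * MvPolynomial.X (i, j)).det := by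
  intro n R _ _ _ u ℓ hu
  classical
  -- `R` is nontrivial (`ℓ 1 = sgn 1 = 1`), so `d ≥ 1` and the bound is `≥ 1`
  have hd : 0 < Module.finrank ℂ R := by
    rcases Nat.eq_zero_or_pos (Module.finrank ℂ R) with h0 | hpos
    · exfalso
      have hR : ∀ x : R, x = 0 := finrank_zero_iff_forall_zero.1 h0
      have h1 := hu 1
      rw [hR (∏ i, u ((1 : Equiv.Perm (Fin n)) i) i), map_zero] at h1
      simp at h1
    · exact hpos
  have hbound : 1 ≤ (n + 1) ^ Module.finrank ℂ R * Module.finrank ℂ R ^ Module.finrank ℂ R :=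
    Nat.one_le_iff_ne_zero.2 (Nat.mul_ne_zero (pow_ne_zero _ (Nat.succ_ne_zero n))
      (pow_ne_zero _ hd.ne'))
  -- the pattern expansion over an index type `T`, reindexed by `Fin (card T)`
  obtain ⟨T, _, c, E, hcard, hrep⟩ :=
    FermionizationDimensionSDimPerNotQPGlobalExpansion.stub_globalExpansion n R u ℓ
  set r := Fintype.card T with hr
  let e : T ≃ Fin r := Fintype.equivFin T
  have hpat : ∀ σ : Equiv.Perm (Fin n),
      ((Equiv.Perm.sign σ : ℤ) : ℂ) = ∑ t : Fin r, c (e.symm t) * ∏ i, E (e.symm t) (σ i) i := by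
    intro σ
    rw [← hu σ, hrep σ]
    exact (Equiv.sum_comp e.symm (fun t => c t * ∏ i, E t (σ i) i)).symm
  rcases Nat.eq_zero_or_pos n with rfl | hn
  · -- `n = 0`: the empty permanent is one empty determinant
    exact ⟨1, hbound, fun _ => 0, perPoly_fin_zero_eq_sum_one _⟩
  · -- `n ≥ 1`: absorb the scalars into column `0`, then compare coefficients
    obtain ⟨F, hF⟩ := exists_rep_of_smul_rep hn _ (fun t => c (e.symm t))
      (fun t i j => E (e.symm t) i j) hpat
    exact ⟨r, hcard, F, (perPoly_eq_sum_twistedDet_iff F).2 hF⟩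

end Summit.ValiantsHypothesis.ValiantsHypothesis.Theorems
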